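import Literature.Computability.Cryptography.QuantumTuringMachine
import Literature.Computability.Complexity.ZIntBricks
import Literature.Computability.Complexity.NSubexp
import HarnessLib

/-!
# Proofs for `QuantumTuringMachine.lean`: acceptance probabilities `≤ 1`; rational amplitudes

Sibling proof file of `QuantumTuringMachine.lean` (D-0014: the named facts there stay `def`s; this
file discharges them). Part I (acceptance probabilities of well-formed QTMs are at most `1`) and
Part II (rational numbers, in particular the Adleman–DeMarrais–Huang amplitudes, are
polynomial-time computable) are independent.

## Part I. Acceptance probabilities of well-formed QTMs are at most `1`

Discharges the named fact `Literature.Computability.Cryptography.QTM.acceptProbAt_le_one` as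
`QTM.acceptProbAt_le_one_holds`.

### The printed argument, as formalised

Bernstein–Vazirani, *Quantum complexity theory*, SIAM J. Comput. 26 (1997), §3.2, p. 1420:
a QTM is *well formed* if its time evolution operator preserves Euclidean length (Def. 3.3);
when a superposition `ψ = ∑ αᵢ cᵢ` is observed, configuration `cᵢ` is seen with probability
`|αᵢ|²`, and a partial measurement returns the sum of `|αᵢ|²` over the configurations consistent
with the answer (Def. 3.4); "the wellformedness condition on a QTM simply says that ... in each
successive superposition, the sum of the probabilities of all possible configurations must be 1"
(remark after Def. 3.4). Hence the probability of observing the accepting control state after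
`t` steps, a partial sum of the `|αᵢ|²` (`QTM.acceptProbAt_le_normSq_stateAt`), is at most the
total `‖stateAt x t‖² = 1` (`QTM.IsWellFormed.normSq_stateAt`), i.e. at most `1`
(`QTM.acceptProbAt_le_one_holds`).

### References (Part I)

* E. Bernstein, U. Vazirani, *Quantum complexity theory*, SIAM J. Comput. 26 (1997)
  1411–1473, doi:10.1137/S0097539796300921: Def. 3.3 (well-formed), Def. 3.4 (observation),
  remark after Def. 3.4, p. 1420.

## Part II. Rational amplitudes are polynomial-time computable

Discharges two further named facts of `QuantumTuringMachine.lean`: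

* `IsPolyTimeComputableReal.ratCast_holds` — every rational number is a polynomial-time
  computable real in the sense of `IsPolyTimeComputableReal` (Ko 1991, §2.1; Bernstein–Vazirani
  1997, Def. 3.2: the class `C̃` of numbers whose real and imaginary parts are computable to within
  `2⁻ⁿ` by a deterministic algorithm in time polynomial in `n`);
* `adhAmplitudes_subset_polyTimeComputableComplex_holds` — the Adleman–DeMarrais–Huang amplitude
  set `{0, ±1, ±3/5, ±4/5}` consists of polynomial-time computable complex numbers, i.e.
  `adhAmplitudes ⊆ polyTimeComputableComplex` (Bernstein–Vazirani 1997, the remark preceding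
  Def. 3.2, on Adleman–DeMarrais–Huang 1997: "restricting QTMs to rational amplitudes does not
  reduce their computational power ... the set of amplitudes `{0, ±3/5, ±4/5, 1}` are sufficient to
  construct a universal QTM").

### Proof

For `q = a / b` (`a : ℤ`, `0 < b`) the dyadic name `f n = ⌊q · 2ⁿ⌋ = (a · 2ⁿ) / b` (integer floor
division) satisfies `0 ≤ q - f n / 2ⁿ < 2⁻ⁿ` (`abs_sub_ediv_two_pow_le`). The string function
`1ⁿ ↦ encodingIntBool.encode (f n)` is assembled from bricks of the tree's `FP` algebra —
`TimeConstructible.powFn 1` (`1ⁿ ↦ bin 2ⁿ`, `NSubexp.lean`), `fanoutFn` and constant functions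
(pairing with the constants `dpEnc a`, `dpEnc b`), `Brick.zmulF` (product of difference-pair
integers), `Brick.zedivF` (`Int.ediv` on canonical difference pairs) and `Brick.signMagOfZF`
(canonical difference pair ↦ the sign–magnitude code `⟨[z < 0], bin |z|⟩`, which is literally
`encodingIntBool.encode z`) (`IntPairBricks.lean`, `ZIntBricks.lean`) — so it is in `FP`, and
`PolyTimeComputable.of_encode` re-indexes it along `unaryEncodeNat`
(`polyTimeComputable_mul_two_pow_ediv`). No machine is written by hand. The seven amplitudes are
then casts of rationals (real part) with imaginary part `0`.

### References (Part II)

* E. Bernstein, U. Vazirani, *Quantum complexity theory*, SIAM J. Comput. 26 (1997) 1411–1473,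
  Def. 3.2 and the remark preceding it (rational amplitudes; `{0, ±3/5, ±4/5, 1}`).
* L. Adleman, J. DeMarrais, M.-D. Huang, *Quantum computability*, SIAM J. Comput. 26 (1997)
  1524–1540 (doi:10.1137/S0097539795293639).
* K.-I. Ko, *Complexity Theory of Real Functions*, Birkhäuser 1991, §2.1 (polynomial-time
  computable real numbers; every rational number is one).
* S. Arora, B. Barak, *Computational Complexity: A Modern Approach*, CUP 2009, §1.3 (polynomial
  time is closed under composition).
-/

namespace Literature.Computability.Cryptography

namespace QTM

variable {M : QTM}

/-- The probability of observing the accepting control state after `t` steps is at most the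
total probability `∑ ‖ψ c‖²` of the superposition reached: configuration `cᵢ` is seen with
probability `|αᵢ|²` and a partial measurement returns the sum of `|αᵢ|²` over the consistent
configurations (Bernstein–Vazirani 1997, Def. 3.4, p. 1420). [cite: BernsteinVazirani1997, Def. 3.4, p. 1420] -/
theorem acceptProbAt_le_normSq_stateAt (x : List Bool) (t : ℕ) :
    M.acceptProbAt x t ≤ M.normSq (M.stateAt x t) := by
  unfold acceptProbAt normSq Finsupp.sum
  refine Finset.sum_le_sum fun c _ => ?_
  dsimp only
  split_ifs
  · exact le_rfl
  · positivity

/-- Discharge of the named fact `QTM.acceptProbAt_le_one`: for a well-formed QTM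
(Bernstein–Vazirani 1997, Def. 3.3: the time evolution preserves Euclidean length) every
superposition reached from the unit-length initial configuration has total probability `1`
("in each successive superposition, the sum of the probabilities of all possible configurations
must be 1", remark after Def. 3.4, p. 1420), and the acceptance probability is a partial sum of
these probabilities (Def. 3.4), hence at most `1`. [cite: BernsteinVazirani1997, Def. 3.3–3.4 and remark p. 1420] -/
theorem acceptProbAt_le_one_holds : acceptProbAt_le_one (M := M) := by
  intro h x t
  exact (acceptProbAt_le_normSq_stateAt x t).trans_eq (h.normSq_stateAt x t)

end QTM

/-! ## Part II. Rational amplitudes are polynomial-time computable -/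

open _root_.Computability Literature.Computability.Complexity
  Literature.Computability.Complexity.Brick Literature.Computability.Complexity.TimeConstructible

/-! ### The dyadic names of a rational are polynomial-time computable -/

/-- **`n ↦ (a · 2ⁿ) / b` (integer division) is polynomial-time computable** from the unary input
`1ⁿ` to the integer code `encodingIntBool`. The string function `1ⁿ ↦ encodingIntBool.encode
((a · 2ⁿ) / b)` is the `FP` composite "pair the constant `dpEnc a` with the difference pair
`⟨bin 2ⁿ, ε⟩` of `2ⁿ` (`powFn 1`), multiply (`zmulF`), pair with the constant `dpEnc b`, divide
(`zedivF`), convert to sign–magnitude (`signMagOfZF`)", re-indexed along `unaryEncodeNat` by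
`PolyTimeComputable.of_encode`. [cite: AroraBarak2009, §1.3] -/
theorem polyTimeComputable_mul_two_pow_ediv (a b : ℤ) :
    PolyTimeComputable unaryEncodeNat encodingIntBool.encode (fun n : ℕ => a * 2 ^ n / b) := by
  have hF : (signMagOfZF ∘ zedivF ∘
      fanoutFn (zmulF ∘ fanoutFn (fun _ => dpEnc a) (fanoutFn id (fun _ => []) ∘ powFn 1))
        (fun _ => dpEnc b)) ∈ FP :=
    comp_mem_FP signMagOfZF_mem_FP
      (comp_mem_FP zedivF_mem_FP
        (fanoutFn_mem_FP
          (comp_mem_FP zmulF_mem_FP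
            (fanoutFn_mem_FP (const_mem_FP _)
              (comp_mem_FP (fanoutFn_mem_FP OracleCompose.id_mem_FP (const_mem_FP _))
                (powFn_mem_FP 1))))
          (const_mem_FP _)))
  refine hF.of_encode (g := unaryEncodeNat) (fun _ => rfl) fun n => ?_
  have h1 : ival (boolPair (encodeNat (2 ^ n)) []) = 2 ^ n := by
    rw [ival_boolPair, bitsToNat_encodeNat, bitsToNat_nil]
    push_cast
    ring
  simp only [Function.comp_apply, fanoutFn_apply, powFn_unary, pow_one, id]
  rw [zmulF_boolPair, ival_dpEnc, h1, zedivF_dpEnc, signMagOfZF_dpEnc]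
  rfl

/-! ### The approximation bound -/

/-- `|a / b - ((a · 2ⁿ) / b) / 2ⁿ| ≤ 2⁻ⁿ` for `0 < b` (integer floor division in the numerator):
indeed `0 ≤ a / b - ⌊a 2ⁿ / b⌋ / 2ⁿ < 2⁻ⁿ`. [folklore] -/
theorem abs_sub_ediv_two_pow_le (a : ℤ) {b : ℕ} (hb : 0 < b) (n : ℕ) :
    |(a : ℝ) / b - ((a * 2 ^ n / b : ℤ) : ℝ) / 2 ^ n| ≤ (1 / 2 : ℝ) ^ n := by
  set k : ℤ := a * 2 ^ n / b with hk
  have hb' : (0 : ℤ) < b := by exact_mod_cast hb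
  have hdecomp : (b : ℤ) * k + a * 2 ^ n % b = a * 2 ^ n :=
    Int.mul_ediv_add_emod (a * 2 ^ n) b
  have hr0 : 0 ≤ a * 2 ^ n % b := Int.emod_nonneg _ hb'.ne'
  have hrd : a * 2 ^ n % b < b := Int.emod_lt_of_pos _ hb'
  have h1 : k * b ≤ a * 2 ^ n := by linarith
  have h2 : a * 2 ^ n ≤ (k + 1) * b := by linarith
  have h1R : (k : ℝ) * b ≤ a * 2 ^ n := by exact_mod_cast h1
  have h2R : (a : ℝ) * 2 ^ n ≤ (k + 1) * b := by exact_mod_cast h2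
  have hbR : (0 : ℝ) < b := by exact_mod_cast hb
  have h2n : (0 : ℝ) < 2 ^ n := by positivity
  have hlo : (k : ℝ) / 2 ^ n ≤ a / b := by
    rw [div_le_iff₀ h2n, div_mul_eq_mul_div, le_div_iff₀ hbR]
    exact h1R
  have hhi : (a : ℝ) / b ≤ (k + 1) / 2 ^ n := by
    rw [le_div_iff₀ h2n, div_mul_eq_mul_div, div_le_iff₀ hbR]
    exact h2R
  have hsplit : ((k : ℝ) + 1) / 2 ^ n = k / 2 ^ n + (1 / 2 : ℝ) ^ n := by
    rw [add_div, one_div_pow]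
  have hpos : (0 : ℝ) ≤ (1 / 2 : ℝ) ^ n := by positivity
  rw [abs_le]
  constructor <;> linarith

/-! ### The discharges -/

/-- **Every rational number is a polynomial-time computable real** (discharge of the named fact
`IsPolyTimeComputableReal.ratCast`): the dyadic name `n ↦ ⌊q 2ⁿ⌋ = (q.num · 2ⁿ) / q.den` is
computable in polynomial time from `1ⁿ` (`polyTimeComputable_mul_two_pow_ediv`) and is within
`2⁻ⁿ` of `q` (`abs_sub_ediv_two_pow_le`) (Ko 1991, §2.1; Bernstein–Vazirani 1997, Def. 3.2).
[cite: Ko1991, §2.1] -/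
theorem IsPolyTimeComputableReal.ratCast_holds : IsPolyTimeComputableReal.ratCast := by
  intro q
  refine ⟨fun n => q.num * 2 ^ n / (q.den : ℤ), polyTimeComputable_mul_two_pow_ediv q.num q.den,
    fun n => ?_⟩
  rw [Rat.cast_def]
  exact abs_sub_ediv_two_pow_le q.num q.den_pos n

/-- Rational complex numbers are polynomial-time computable: the real part is a rational
(`IsPolyTimeComputableReal.ratCast_holds`), the imaginary part is `0`
(Bernstein–Vazirani 1997, Def. 3.2 and the remark preceding it). [cite: BernsteinVazirani1997, Def. 3.2] -/
theorem isPolyTimeComputableComplex_ratCast (q : ℚ) : IsPolyTimeComputableComplex (q : ℂ) := by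
  refine ⟨?_, ?_⟩
  · simpa using IsPolyTimeComputableReal.ratCast_holds q
  · simpa using IsPolyTimeComputableReal.ratCast_holds 0

/-- **The Adleman–DeMarrais–Huang amplitudes are polynomial-time computable** (discharge of the
named fact `adhAmplitudes_subset_polyTimeComputableComplex`): each of `0, ±1, ±3/5, ±4/5` is the
cast of a rational number, hence lies in Bernstein–Vazirani's class `C̃` =
`polyTimeComputableComplex` (`isPolyTimeComputableComplex_ratCast`; Bernstein–Vazirani 1997,
Def. 3.2 and the preceding remark on the rational amplitude set `{0, ±3/5, ±4/5, 1}` of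
Adleman–DeMarrais–Huang 1997). [cite: AdlemanDeMarraisHuang1997] -/
theorem adhAmplitudes_subset_polyTimeComputableComplex_holds :
    adhAmplitudes_subset_polyTimeComputableComplex := by
  unfold adhAmplitudes_subset_polyTimeComputableComplex
  intro z hz
  rw [mem_polyTimeComputableComplex_iff]
  simp only [adhAmplitudes, Set.mem_insert_iff, Set.mem_singleton_iff] at hz
  rcases hz with rfl | rfl | rfl | rfl | rfl | rfl | rfl
  · simpa using isPolyTimeComputableComplex_ratCast 0
  · simpa using isPolyTimeComputableComplex_ratCast 1
  · simpa using isPolyTimeComputableComplex_ratCast (-1)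
  · simpa using isPolyTimeComputableComplex_ratCast (3 / 5)
  · simpa using isPolyTimeComputableComplex_ratCast (-3 / 5)
  · simpa using isPolyTimeComputableComplex_ratCast (4 / 5)
  · simpa using isPolyTimeComputableComplex_ratCast (-4 / 5)

end Literature.Computability.Cryptography
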